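import Mathlib.LinearAlgebra.Matrix.Trace
import Literature.Topology.FourManifolds.SpecialLinearPath
import HarnessLib

/-!
# Gompf 2010 §4: linear straightenings (Def. 4.1, Prop. 4.2) and the matrices of Theorem 4.3

Part of the decomposition of the named fact
`Literature.Topology.FourManifolds.nonempty_diffeomorph_sphere_four_of_isCappellShanesonSphereOf` (R. Gompf, *More
Cappell–Shaneson spheres are standard*, Algebr. Geom. Topol. 10 (2010)), on the branch of
Theorem 4.3 (the two Cappell–Shaneson spheres of `A₀` are diffeomorphic). Gompf, §4: a
*straightening* of `A ∈ GL(V)` (Definition 4.1) is a homotopy class of paths in `GL(V)` from `A`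
to `I`; it is the datum that fixes the framing of the Cappell–Shaneson surgery, and `A` "can be
linearly straightened" when the straight segment `t ↦ t A + (1 - t) I` consists of invertible
matrices. **Proposition 4.2**: a real Cappell–Shaneson matrix (`A ∈ SL(3, ℝ)`, `det (A - I) = 1`)
with `tr A ≥ 0` can be linearly straightened. We vendor the segment (`Literature.Topology.FourManifolds.linearPath`), the
predicate (`Literature.Topology.FourManifolds.IsLinearlyStraightenable`) and **prove** Proposition 4.2
(`Literature.Topology.FourManifolds.isLinearlyStraightenable_of_trace_nonneg`), via the closed formula
`det (t A + (1 - t) I) = t³ + t² (1 - t) (tr A - 1) + t (1 - t)² tr A + (1 - t)³`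
(`Literature.Topology.FourManifolds.det_linearPath_of_cappellShaneson`) for such `A` — Gompf's "`t³ det (A + (1/t - 1) I)`"
computed from the characteristic polynomial `λ³ - tr(A) λ² + (tr(A) - 1) λ - 1`. We also record
the explicit matrices `A`, `B = C A C⁻¹`, `C` of the proof of **Theorem 4.3** (`Literature.Topology.FourManifolds.gompfFramingA`,
`Literature.Topology.FourManifolds.gompfFramingB`, `Literature.Topology.FourManifolds.gompfFramingC`, `Literature.Topology.FourManifolds.gompfFramingB_eq_conj`), that `A`, `B` are trace-`4`
Cappell–Shaneson matrices with linear straightenings `σ_A`, `σ_B`, and the segment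
`ρ : B_t = t B + (1 - t) A` with Gompf's formula `det (B_t + s I) = s³ + 4s² + [4t(1-t) + 3]s + 1 > 0`
(`Literature.Topology.FourManifolds.det_gompfFramingSegment_add`), so that every `B_t` lies in `GL⁺(3, ℝ)` and can be linearly
straightened (`Literature.Topology.FourManifolds.isLinearlyStraightenable_gompfFramingSegment`) — the "2-simplex of linear
straightenings with edges `σ_A`, `σ_B`, `ρ`" of that proof. Everything here is proved; what is
*not* here is the topology of §4 (straightened monodromies `X^σ_φ`, the framed form of Theorem 2.1,
and the mod-`2` winding number concluding Theorem 4.3).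

## References

* R. E. Gompf, *More Cappell–Shaneson spheres are standard*, Algebr. Geom. Topol. 10 (2010)
  1665–1681, doi:10.2140/agt.2010.10.1665 (arXiv:0908.1914): §4, Definition 4.1,
  Proposition 4.2, and the proof of Theorem 4.3 (matrices `A`, `B`, `C`, the path `ρ`). [GompfAGT2010]
-/

open Set

noncomputable section

namespace Literature.Topology.FourManifolds

/-- **The straight-line path of matrices from `I` to `A`**: `linearPath A t = t • A + (1 - t) • 1`,
so `linearPath A 0 = 1` and `linearPath A 1 = A` (Gompf 2010, §4: "the linear path from `A` to
`I`", traversed backwards). [cite: GompfAGT2010, Def. 4.1 and Prop. 4.2 (linear straightening)] -/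
def linearPath {n : Type*} [Fintype n] [DecidableEq n] (A : Matrix n n ℝ) (t : ℝ) : Matrix n n ℝ :=
  t • A + (1 - t) • (1 : Matrix n n ℝ)

/-- `linearPath A 0 = 1`. [folklore] -/
@[simp] theorem linearPath_zero {n : Type*} [Fintype n] [DecidableEq n] (A : Matrix n n ℝ) :
    linearPath A 0 = 1 := by
  simp [linearPath]

/-- `linearPath A 1 = A`. [folklore] -/
@[simp] theorem linearPath_one {n : Type*} [Fintype n] [DecidableEq n] (A : Matrix n n ℝ) :
    linearPath A 1 = A := by
  simp [linearPath]

/-- Entries of the straight-line path. [folklore] -/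
theorem linearPath_apply {n : Type*} [Fintype n] [DecidableEq n] (A : Matrix n n ℝ) (t : ℝ)
    (i j : n) : linearPath A t i j = t * A i j + (1 - t) * (1 : Matrix n n ℝ) i j := by
  simp [linearPath, Matrix.add_apply, Matrix.smul_apply]

/-- **Linearly straightenable matrices** (Gompf 2010, Def. 4.1 / Prop. 4.2): `A` "can be linearly
straightened" if the straight segment from `A` to `I` lies in `GL(n, ℝ)`, i.e. every
`t A + (1 - t) I`, `t ∈ [0, 1]`, is invertible; its homotopy class is then *the linear
straightening* `σ_A` of `A`. [cite: GompfAGT2010, Def. 4.1 and Prop. 4.2 (linear straightening)] -/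
def IsLinearlyStraightenable {n : Type*} [Fintype n] [DecidableEq n] (A : Matrix n n ℝ) : Prop :=
  ∀ t ∈ Icc (0 : ℝ) 1, IsUnit (linearPath A t).det

/-- **The determinant along the segment, for a real Cappell–Shaneson matrix.** If
`A ∈ M₃(ℝ)` has `det A = 1` and `det (A - 1) = 1`, then
`det (t A + (1 - t) I) = t³ + t² (1 - t) (tr A - 1) + t (1 - t)² tr A + (1 - t)³`: the
coefficient of `t² (1 - t)` is the second elementary symmetric function `e₂(A)` of the eigenvalues,
and `det (A - I) = det A - e₂(A) + tr A - 1` forces `e₂(A) = tr A - 1` (Gompf 2010, proof of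
Prop. 4.2: the characteristic polynomial is `λ³ - tr(A) λ² + (tr(A) - 1) λ - 1`, "where the last
expression comes from setting `λ = 0, 1` and comparing with the Cappell–Shaneson conditions"). [cite: GompfAGT2010, Prop. 4.2 (proof)] -/
theorem det_linearPath_of_cappellShaneson (A : Matrix (Fin 3) (Fin 3) ℝ) (hdet : A.det = 1)
    (hcs : (A - 1).det = 1) (t : ℝ) :
    (linearPath A t).det =
      t ^ 3 + t ^ 2 * (1 - t) * (A.trace - 1) + t * (1 - t) ^ 2 * A.trace + (1 - t) ^ 3 := by
  have h1 : (linearPath A t).det = t ^ 3 * A.det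
      + t ^ 2 * (1 - t) * (A 0 0 * A 1 1 - A 0 1 * A 1 0 + A 0 0 * A 2 2 - A 0 2 * A 2 0
          + A 1 1 * A 2 2 - A 1 2 * A 2 1)
      + t * (1 - t) ^ 2 * A.trace + (1 - t) ^ 3 := by
    simp only [Matrix.det_fin_three, Matrix.trace_fin_three, linearPath_apply, Matrix.one_apply_eq,
      Matrix.one_apply_ne (by decide : (0 : Fin 3) ≠ 1), Matrix.one_apply_ne (by decide : (0 : Fin 3) ≠ 2),
      Matrix.one_apply_ne (by decide : (1 : Fin 3) ≠ 0), Matrix.one_apply_ne (by decide : (1 : Fin 3) ≠ 2),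
      Matrix.one_apply_ne (by decide : (2 : Fin 3) ≠ 0), Matrix.one_apply_ne (by decide : (2 : Fin 3) ≠ 1)]
    ring
  have h2 : (A - 1).det = A.det
      - (A 0 0 * A 1 1 - A 0 1 * A 1 0 + A 0 0 * A 2 2 - A 0 2 * A 2 0 + A 1 1 * A 2 2 - A 1 2 * A 2 1)
      + A.trace - 1 := by
    simp only [Matrix.det_fin_three, Matrix.trace_fin_three, Matrix.sub_apply, Matrix.one_apply_eq,
      Matrix.one_apply_ne (by decide : (0 : Fin 3) ≠ 1), Matrix.one_apply_ne (by decide : (0 : Fin 3) ≠ 2),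
      Matrix.one_apply_ne (by decide : (1 : Fin 3) ≠ 0), Matrix.one_apply_ne (by decide : (1 : Fin 3) ≠ 2),
      Matrix.one_apply_ne (by decide : (2 : Fin 3) ≠ 0), Matrix.one_apply_ne (by decide : (2 : Fin 3) ≠ 1)]
    ring
  rw [h1]
  rw [hdet] at h2 ⊢
  linear_combination (t ^ 2 * (1 - t)) * (h2 - hcs)

/-- The cubic `1 - 3 t + 2 t² + t³ = (1 - t)(1 - 2t) + t³` is positive on `[0, 1]`. [folklore] -/
theorem gompf_cubic_pos {t : ℝ} (h0 : 0 ≤ t) (h1 : t ≤ 1) : 0 < 1 - 3 * t + 2 * t ^ 2 + t ^ 3 := by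
  rcases le_or_gt t (1 / 2) with h | h
  · nlinarith [mul_nonneg (sub_nonneg.2 h1) (by linarith : (0 : ℝ) ≤ 1 - 2 * t), pow_nonneg h0 3,
      sq_nonneg t]
  · nlinarith [sq_nonneg (t - 1 / 2), mul_pos (by linarith : (0 : ℝ) < t) (by linarith : (0 : ℝ) < t)]

/-- **Positivity of the determinant along the segment** for a real Cappell–Shaneson matrix with
`tr A ≥ 0`: for `t ∈ [0, 1]`,
`det (t A + (1 - t) I) = [t³ + (1 - t)³ - t² (1 - t)] + tr A · t (1 - t) > 0`. [cite: GompfAGT2010, Prop. 4.2 (proof)] -/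
theorem det_linearPath_pos_of_trace_nonneg (A : Matrix (Fin 3) (Fin 3) ℝ) (hdet : A.det = 1)
    (hcs : (A - 1).det = 1) (htr : 0 ≤ A.trace) {t : ℝ} (h0 : 0 ≤ t) (h1 : t ≤ 1) :
    0 < (linearPath A t).det := by
  rw [det_linearPath_of_cappellShaneson A hdet hcs t]
  have hc := gompf_cubic_pos h0 h1
  have ht : 0 ≤ A.trace * (t * (1 - t)) := mul_nonneg htr (mul_nonneg h0 (by linarith))
  nlinarith [hc, ht]

/-- **Gompf 2010, Proposition 4.2 (proved).** "Let `A` be a real Cappell–Shaneson matrix, that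
is, `A ∈ SL(3, ℝ)` with `det (A - I) = 1`. If `tr(A) ≥ 0` then `A` can be linearly straightened":
the linear path from `A` to `I` lies in `GL(3, ℝ)` — "for `0 < t < 1` we have
`0 ≠ det (t A + (1 - t) I) = t³ det (A + (1/t - 1) I)`. Equivalently, … there are no negative
roots of the characteristic polynomial `λ³ - tr(A) λ² + (tr(A) - 1) λ - 1` …, the same as ruling
out positive roots of `s³ + tr(A) s² + (tr(A) - 1) s + 1`, which is obvious for `tr(A) ≥ 1` and
not much harder for `tr(A) ≥ 0`." [cite: GompfAGT2010, Prop. 4.2] -/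
theorem isLinearlyStraightenable_of_trace_nonneg (A : Matrix (Fin 3) (Fin 3) ℝ) (hdet : A.det = 1)
    (hcs : (A - 1).det = 1) (htr : 0 ≤ A.trace) : IsLinearlyStraightenable A :=
  fun _ ht ↦ (det_linearPath_pos_of_trace_nonneg A hdet hcs htr ht.1 ht.2).ne'.isUnit

/-- Proposition 4.2 for integer Cappell–Shaneson matrices `A ∈ SL(3, ℤ)`, `det (A - 1) = 1`,
`tr A ≥ 0` (e.g. `A₀`, trace `2`, and Gompf's trace-`4` matrices `A`, `B` of Thm 4.3): the real
matrix `slRealMatrix A` (`SpecialLinearPath.lean`) can be linearly straightened. [cite: GompfAGT2010, Prop. 4.2] -/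
theorem isLinearlyStraightenable_slRealMatrix_of_trace_nonneg
    (A : Matrix.SpecialLinearGroup (Fin 3) ℤ) (hcs : ((A : Matrix (Fin 3) (Fin 3) ℤ) - 1).det = 1)
    (htr : 0 ≤ (A : Matrix (Fin 3) (Fin 3) ℤ).trace) :
    IsLinearlyStraightenable (slRealMatrix A) := by
  refine isLinearlyStraightenable_of_trace_nonneg _ (det_slRealMatrix A) ?_ ?_
  · have h := RingHom.map_det (Int.castRingHom ℝ) ((A : Matrix (Fin 3) (Fin 3) ℤ) - 1)
    rw [hcs, map_one, map_sub, map_one] at h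
    rw [slRealMatrix]
    exact h.symm
  · have h : (slRealMatrix A).trace = (((A : Matrix (Fin 3) (Fin 3) ℤ).trace : ℤ) : ℝ) := by
      simp [Matrix.trace_fin_three]
    rw [h]
    exact_mod_cast htr

/-! ### The matrices of the proof of Theorem 4.3 and the segment between them -/

section FramingMatrices

/-- **Gompf's trace-`4` Cappell–Shaneson matrix `A = !![0, -1, -2; 0, -1, -3; 1, 2, 5]`**, the
start of the chain of four Δ/Δ₀-moves in the proof of Theorem 4.3 (Gompf 2010, §4, proof of
Thm 4.3, first display). [cite: GompfAGT2010, Thm 4.3 (proof, the matrix A)] -/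
def gompfFramingA : Matrix.SpecialLinearGroup (Fin 3) ℤ :=
  ⟨!![0, -1, -2; 0, -1, -3; 1, 2, 5], by decide⟩

/-- **The matrix `B = !![0, -1, -2; 0, 1, 1; 1, 2, 3] = Δ² A₀`** ending the chain in the proof of
Theorem 4.3 (Gompf 2010, §4). [cite: GompfAGT2010, Thm 4.3 (proof, the matrix B)] -/
def gompfFramingB : Matrix.SpecialLinearGroup (Fin 3) ℤ :=
  ⟨!![0, -1, -2; 0, 1, 1; 1, 2, 3], by decide⟩

/-- **The conjugator `C = !![2, 1, 2; 0, -1, -1; -1, 0, -1]`** with `B = C A C⁻¹`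
(Gompf 2010, §4, proof of Thm 4.3). [cite: GompfAGT2010, Thm 4.3 (proof, the matrix C)] -/
def gompfFramingC : Matrix.SpecialLinearGroup (Fin 3) ℤ :=
  ⟨!![2, 1, 2; 0, -1, -1; -1, 0, -1], by decide⟩

/-- The underlying matrix of `gompfFramingA`. [folklore] -/
@[simp] theorem coe_gompfFramingA :
    (gompfFramingA : Matrix (Fin 3) (Fin 3) ℤ) = !![0, -1, -2; 0, -1, -3; 1, 2, 5] := rfl

/-- The underlying matrix of `gompfFramingB`. [folklore] -/
@[simp] theorem coe_gompfFramingB :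
    (gompfFramingB : Matrix (Fin 3) (Fin 3) ℤ) = !![0, -1, -2; 0, 1, 1; 1, 2, 3] := rfl

/-- The underlying matrix of `gompfFramingC`. [folklore] -/
@[simp] theorem coe_gompfFramingC :
    (gompfFramingC : Matrix (Fin 3) (Fin 3) ℤ) = !![2, 1, 2; 0, -1, -1; -1, 0, -1] := rfl

/-- `C⁻¹ = !![1, 1, 1; 1, 0, 2; -1, -1, -2]` (Gompf 2010, §4, proof of Thm 4.3). [cite: GompfAGT2010, Thm 4.3 (proof, the matrix C⁻¹)] -/
theorem coe_gompfFramingC_inv :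
    ((gompfFramingC⁻¹ : Matrix.SpecialLinearGroup (Fin 3) ℤ) : Matrix (Fin 3) (Fin 3) ℤ) =
      !![1, 1, 1; 1, 0, 2; -1, -1, -2] := by
  rw [Matrix.SpecialLinearGroup.coe_inv, coe_gompfFramingC]
  ext i j
  fin_cases i <;> fin_cases j <;> simp [Matrix.adjugate_fin_three]

/-- **`A` and `B` are conjugate: `B = C A C⁻¹`** ("`A` and `B` are conjugate since
`tr(A) = tr(B) = 4`. In fact, `B = C A C⁻¹`"; Gompf 2010, proof of Thm 4.3). [cite: GompfAGT2010, Thm 4.3 (proof, B = CAC⁻¹)] -/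
theorem gompfFramingB_eq_conj : gompfFramingB = gompfFramingC * gompfFramingA * gompfFramingC⁻¹ := by
  ext i j
  rw [Matrix.SpecialLinearGroup.coe_mul, Matrix.SpecialLinearGroup.coe_mul, coe_gompfFramingC_inv,
    coe_gompfFramingA, coe_gompfFramingB, coe_gompfFramingC]
  fin_cases i <;> fin_cases j <;> simp [Matrix.mul_apply, Fin.sum_univ_three]

/-- `A` is a Cappell–Shaneson matrix: `det (A - 1) = 1`. [cite: GompfAGT2010, Thm 4.3 (proof, the matrix A)] -/
theorem det_gompfFramingA_sub_one : ((gompfFramingA : Matrix (Fin 3) (Fin 3) ℤ) - 1).det = 1 := by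
  decide

/-- `B` is a Cappell–Shaneson matrix: `det (B - 1) = 1`. [cite: GompfAGT2010, Thm 4.3 (proof, the matrix B)] -/
theorem det_gompfFramingB_sub_one : ((gompfFramingB : Matrix (Fin 3) (Fin 3) ℤ) - 1).det = 1 := by
  decide

/-- `tr A = 4`. [cite: GompfAGT2010, Thm 4.3 (proof, tr A = tr B = 4)] -/
theorem trace_gompfFramingA : (gompfFramingA : Matrix (Fin 3) (Fin 3) ℤ).trace = 4 := by
  decide

/-- `tr B = 4`. [cite: GompfAGT2010, Thm 4.3 (proof, tr A = tr B = 4)] -/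
theorem trace_gompfFramingB : (gompfFramingB : Matrix (Fin 3) (Fin 3) ℤ).trace = 4 := by
  decide

/-- `A` can be linearly straightened (Prop. 4.2, `tr A = 4 ≥ 0`): the linear straightening `σ_A`
of the proof of Thm 4.3 exists. [cite: GompfAGT2010, Thm 4.3 (proof, σ_A)] -/
theorem isLinearlyStraightenable_gompfFramingA : IsLinearlyStraightenable (slRealMatrix gompfFramingA) :=
  isLinearlyStraightenable_slRealMatrix_of_trace_nonneg _ det_gompfFramingA_sub_one
    (by rw [trace_gompfFramingA]; norm_num)

/-- `B` can be linearly straightened (Prop. 4.2, `tr B = 4 ≥ 0`): `σ_B` exists. [cite: GompfAGT2010, Thm 4.3 (proof, σ_B)] -/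
theorem isLinearlyStraightenable_gompfFramingB : IsLinearlyStraightenable (slRealMatrix gompfFramingB) :=
  isLinearlyStraightenable_slRealMatrix_of_trace_nonneg _ det_gompfFramingB_sub_one
    (by rw [trace_gompfFramingB]; norm_num)

/-- **The segment `ρ` from `A` to `B`**: `B_t = t B + (1 - t) A`, `0 ≤ t ≤ 1` (Gompf 2010, proof
of Thm 4.3: "consider the linear path `ρ` between `A` and `B`, given by the family of matrices
`B_t = tB + (1-t)A`"). [cite: GompfAGT2010, Thm 4.3 (proof, the path ρ)] -/
def gompfFramingSegment (t : ℝ) : Matrix (Fin 3) (Fin 3) ℝ :=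
  t • slRealMatrix gompfFramingB + (1 - t) • slRealMatrix gompfFramingA

/-- Entries of the segment. [folklore] -/
theorem gompfFramingSegment_apply (t : ℝ) (i j : Fin 3) :
    gompfFramingSegment t i j =
      t * ((gompfFramingB : Matrix (Fin 3) (Fin 3) ℤ) i j : ℝ) +
        (1 - t) * ((gompfFramingA : Matrix (Fin 3) (Fin 3) ℤ) i j : ℝ) := by
  simp [gompfFramingSegment, Matrix.add_apply, Matrix.smul_apply]

/-- **Gompf's determinant along the segment**: `det (B_t + s I) = s³ + 4 s² + [4t(1-t) + 3] s + 1`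
("where the last expression arises by direct calculation"; Gompf 2010, proof of Thm 4.3). [cite: GompfAGT2010, Thm 4.3 (proof, det(B_t + sI))] -/
theorem det_gompfFramingSegment_add (t s : ℝ) :
    (gompfFramingSegment t + s • (1 : Matrix (Fin 3) (Fin 3) ℝ)).det =
      s ^ 3 + 4 * s ^ 2 + (4 * t * (1 - t) + 3) * s + 1 := by
  simp only [Matrix.det_fin_three, Matrix.add_apply, Matrix.smul_apply, gompfFramingSegment_apply,
    coe_gompfFramingA, coe_gompfFramingB, Matrix.one_apply_eq,
    Matrix.one_apply_ne (by decide : (0 : Fin 3) ≠ 1), Matrix.one_apply_ne (by decide : (0 : Fin 3) ≠ 2),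
    Matrix.one_apply_ne (by decide : (1 : Fin 3) ≠ 0), Matrix.one_apply_ne (by decide : (1 : Fin 3) ≠ 2),
    Matrix.one_apply_ne (by decide : (2 : Fin 3) ≠ 0), Matrix.one_apply_ne (by decide : (2 : Fin 3) ≠ 1)]
  simp
  ring

/-- The determinant along the segment is positive for `s ≥ 0`, `0 ≤ t ≤ 1` ("clearly positive";
Gompf 2010, proof of Thm 4.3). [cite: GompfAGT2010, Thm 4.3 (proof, det(B_t + sI) > 0)] -/
theorem det_gompfFramingSegment_add_pos {t s : ℝ} (h0 : 0 ≤ t) (h1 : t ≤ 1) (hs : 0 ≤ s) :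
    0 < (gompfFramingSegment t + s • (1 : Matrix (Fin 3) (Fin 3) ℝ)).det := by
  rw [det_gompfFramingSegment_add]
  have h2 : 0 ≤ 4 * t * (1 - t) := by nlinarith
  positivity

/-- **Every matrix `B_t` of the segment lies in `GL⁺(3, ℝ)` and can be linearly straightened**
("These matrices all lie in `GL⁺(3, ℝ)` and can be linearly straightened. This follows as in the
proof of Proposition 4.2, by verifying that for `s ≥ 0`, `0 ≠ det (B_t + sI)`"; Gompf 2010, proof
of Thm 4.3): for `u ∈ (0, 1]`, `u B_t + (1 - u) I = u (B_t + (1/u - 1) I)` has positive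
determinant, and `u = 0` gives `I`. [cite: GompfAGT2010, Thm 4.3 (proof, the 2-simplex of linear straightenings)] -/
theorem isLinearlyStraightenable_gompfFramingSegment {t : ℝ} (h0 : 0 ≤ t) (h1 : t ≤ 1) :
    IsLinearlyStraightenable (gompfFramingSegment t) := by
  intro u hu
  rcases hu.1.eq_or_lt with rfl | hu0
  · simp [linearPath]
  · have hs : 0 ≤ (1 - u) / u := div_nonneg (sub_nonneg.2 hu.2) hu0.le
    have h : linearPath (gompfFramingSegment t) u =
        u • (gompfFramingSegment t + ((1 - u) / u) • (1 : Matrix (Fin 3) (Fin 3) ℝ)) := by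
      rw [linearPath, smul_add, smul_smul, mul_div_cancel₀ _ hu0.ne']
    rw [h, Matrix.det_smul, Fintype.card_fin]
    exact (mul_pos (pow_pos hu0 3) (det_gompfFramingSegment_add_pos h0 h1 hs)).ne'.isUnit

/-- The segment has positive determinant throughout: `B_t ∈ GL⁺(3, ℝ)`. [cite: GompfAGT2010, Thm 4.3 (proof, B_t ∈ GL⁺(3,ℝ))] -/
theorem det_gompfFramingSegment_pos {t : ℝ} (h0 : 0 ≤ t) (h1 : t ≤ 1) :
    0 < (gompfFramingSegment t).det := by
  have := det_gompfFramingSegment_add_pos h0 h1 le_rfl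
  rwa [zero_smul, add_zero] at this

end FramingMatrices

end Literature.Topology.FourManifolds
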